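import Literature.NumberTheory.Transcendental.ProjectiveSpace
import HarnessLib

/-!
# Projective space `ℙⁿ(𝕜)` is an analytic manifold (proof file)

Sibling proof file of `Literature/NumberTheory/Transcendental/ProjectiveSpace.lean`. That file
equips Mathlib's projectivization `ℙ 𝕜 (Fin (n + 1) → 𝕜)` with the quotient topology and the
charted-space structure given by the `n + 1` standard affine charts
`stdChart i : Uᵢ = {zᵢ ≠ 0} → 𝕜ⁿ`, `[z] ↦ (z_{i.succAbove k} / zᵢ)_k`, with inverse
`stdChartInv i : w ↦ [w₀ : ⋯ : 1 : ⋯ : w_{n-1}]` (the `1` inserted in position `i`, i.e.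
`Fin.insertNth i 1 w`), and it vendors as a *named fact* `Literature.isManifold_projectivization 𝕜 n`
the statement that `ℙⁿ(𝕜)` with this atlas is a `C^ω` (analytic) manifold modelled on `𝕜ⁿ`.
This file **discharges that fact** (`Literature.NumberTheory.Transcendental.isManifold_projectivization_holds`), with no non-Mathlib
input.

The argument is the one of Huybrechts, *Complex Geometry*, §2.1 pp. 56–57 (example "Projective
space"): with `Uᵢ = {zᵢ ≠ 0}` and `φᵢ : Uᵢ → ℂⁿ, (z₀ : … : zₙ) ↦ (z₀/zᵢ, …, ẑᵢ, …, zₙ/zᵢ)`, the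
transition maps `φᵢⱼ = φᵢ ∘ φⱼ⁻¹` on `φⱼ(Uᵢ ∩ Uⱼ) = ℂⁿ ∖ Z(wᵢ)` are
`(w₁, …, wₙ) ↦ (w₁/wᵢ, …, 1/wᵢ, …, wₙ/wᵢ)`, and "These maps are obviously bijective and
holomorphic", so `{(Uᵢ, φᵢ)}` is a holomorphic atlas (Definition 2.1.1, p. 52); see also
Griffiths–Harris p. 15. In Lean: `Projectivization.stdChartFun_comp_stdChartInv` is that formula
in the `Fin.insertNth` / `Fin.succAbove` indexing of the sibling file (each component of
`φⱼ ∘ φᵢ⁻¹` is `w ↦ (insertNth i 1 w)_{j.succAbove k} / (insertNth i 1 w)_j`, a coordinate or the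
constant `1` divided by a coordinate or `1`); `Projectivization.contDiffOn_stdChartFun_comp_stdChartInv`
is its analyticity on `{w | (insertNth i 1 w)_j ≠ 0}` (`ContDiffOn.div`; inversion is `C^ω` on
any normed field, the geometric series being summable there, `contDiffAt_inv`);
`Projectivization.stdChart_symm_trans_source` identifies that set with the source of
`(stdChart i).symm ≫ₕ stdChart j`; and `Literature.NumberTheory.Transcendental.isManifold_projectivization_holds` assembles the `C^ω`
structure with `isManifold_of_contDiffOn` over the atlas `range stdChart`. The argument is
field-independent, so it is carried out for every nontrivially normed field `𝕜`, exactly as the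
fact is stated.

## Main statements

* `Projectivization.stdChartFun_comp_stdChartInv` — the transition map `φⱼ ∘ φᵢ⁻¹` in coordinates.
* `Projectivization.contDiffOn_stdChart_symm_trans` — the transition map
  `(stdChart i).symm ≫ₕ stdChart j` is `C^ω` on its source.
* `Literature.NumberTheory.Transcendental.isManifold_projectivization_holds` — the named fact `Literature.isManifold_projectivization 𝕜 n`
  holds: `IsManifold 𝓘(𝕜, Fin n → 𝕜) ω (ℙ 𝕜 (Fin (n + 1) → 𝕜))`.

## References

* D. Huybrechts, *Complex Geometry. An Introduction*, Universitext, Springer (2005), §2.1,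
  Definition 2.1.1 (p. 52) and pp. 56–57 (Projective space). [HuybrechtsCG2005]
* P. Griffiths, J. Harris, *Principles of Algebraic Geometry* (1978), p. 15.
-/

noncomputable section

open scoped LinearAlgebra.Projectivization Manifold ContDiff
open Set Function Topology

namespace Projectivization

section Transition

variable {𝕜 : Type*} [NontriviallyNormedField 𝕜] {n : ℕ}

/-- Each homogeneous coordinate of the inverse chart, `w ↦ (w₀, …, 1, …, w_{n-1})_m` (the `1` in
position `i`), is analytic on `𝕜ⁿ`: it is either the constant `1` (`m = i`) or a coordinate
projection (`m = i.succAbove k`). [cite: HuybrechtsCG2005, §2.1 pp. 56–57] -/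
theorem contDiff_insertNth_one_apply (i m : Fin (n + 1)) :
    ContDiff 𝕜 ω fun w : Fin n → 𝕜 ↦ (Fin.insertNth i (1 : 𝕜) w : Fin (n + 1) → 𝕜) m := by
  refine Fin.succAboveCases i ?_ (fun k ↦ ?_) m
  · simp only [Fin.insertNth_apply_same]
    exact contDiff_const
  · simp only [Fin.insertNth_apply_succAbove]
    exact contDiff_apply 𝕜 𝕜 k

/-- The transition map `φⱼ ∘ φᵢ⁻¹` between two standard affine charts of `ℙⁿ(𝕜)` is, in
coordinates, `w ↦ ((w₀, …, 1, …, w_{n-1})_{j.succAbove k} / (w₀, …, 1, …, w_{n-1})_j)_k`.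
[cite: HuybrechtsCG2005, §2.1 p. 57 (formula for `φᵢⱼ`)] -/
theorem stdChartFun_comp_stdChartInv (i j : Fin (n + 1)) :
    (stdChartFun j ∘ stdChartInv i : (Fin n → 𝕜) → Fin n → 𝕜) = fun w k ↦
      (Fin.insertNth i (1 : 𝕜) w : Fin (n + 1) → 𝕜) (j.succAbove k) /
        (Fin.insertNth i (1 : 𝕜) w : Fin (n + 1) → 𝕜) j := by
  funext w
  simp only [comp_apply, stdChartInv, stdChartFun_mk]

/-- The transition map `φⱼ ∘ φᵢ⁻¹` between two standard affine charts of `ℙⁿ(𝕜)` is analytic on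
`φᵢ(Uᵢ ∩ Uⱼ) = {w | (w₀, …, 1, …, w_{n-1})_j ≠ 0}`: its components are quotients of analytic
functions by a nonvanishing analytic function. [cite: HuybrechtsCG2005, §2.1 p. 57 ("These maps are
obviously bijective and holomorphic")] -/
theorem contDiffOn_stdChartFun_comp_stdChartInv (i j : Fin (n + 1)) :
    ContDiffOn 𝕜 ω (stdChartFun j ∘ stdChartInv i : (Fin n → 𝕜) → Fin n → 𝕜)
      {w | (Fin.insertNth i (1 : 𝕜) w : Fin (n + 1) → 𝕜) j ≠ 0} := by
  rw [stdChartFun_comp_stdChartInv]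
  refine contDiffOn_pi.2 fun k ↦ ?_
  exact ContDiffOn.fun_div (contDiff_insertNth_one_apply i _).contDiffOn
    (contDiff_insertNth_one_apply i j).contDiffOn fun w hw ↦ hw

/-- The source `φᵢ(Uᵢ ∩ Uⱼ)` of the transition map `(stdChart i)⁻¹ ≫ stdChart j` is
`{w | (w₀, …, 1, …, w_{n-1})_j ≠ 0}`. [cite: HuybrechtsCG2005, §2.1 p. 57
(`φⱼ(Uᵢ ∩ Uⱼ) = ℂⁿ ∖ Z(wᵢ)`)] -/
theorem stdChart_symm_trans_source (i j : Fin (n + 1)) :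
    ((stdChart i).symm ≫ₕ stdChart j :
        OpenPartialHomeomorph (Fin n → 𝕜) (Fin n → 𝕜)).source =
      {w | (Fin.insertNth i (1 : 𝕜) w : Fin (n + 1) → 𝕜) j ≠ 0} := by
  ext w
  simp [stdChartInv]

/-- The transition map `(stdChart i)⁻¹ ≫ stdChart j` is analytic (`C^ω`) on its source.
[cite: HuybrechtsCG2005, §2.1 p. 57] -/
theorem contDiffOn_stdChart_symm_trans (i j : Fin (n + 1)) :
    ContDiffOn 𝕜 ω ((stdChart i).symm ≫ₕ stdChart j :
        OpenPartialHomeomorph (Fin n → 𝕜) (Fin n → 𝕜))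
      ((stdChart i).symm ≫ₕ stdChart j :
        OpenPartialHomeomorph (Fin n → 𝕜) (Fin n → 𝕜)).source := by
  rw [stdChart_symm_trans_source, OpenPartialHomeomorph.coe_trans]
  exact contDiffOn_stdChartFun_comp_stdChartInv i j

end Transition

end Projectivization

namespace Literature.NumberTheory.Transcendental

open Projectivization

section GlobalProofs

variable (𝕜 : Type*) [NontriviallyNormedField 𝕜] (n : ℕ)

/-- **Discharge of `Literature.NumberTheory.Transcendental.isManifold_projectivization`.** Projective space `ℙⁿ(𝕜)` with its
standard atlas `{(Uᵢ, φᵢ)}` (`Projectivization.instChartedSpace`, atlas `range stdChart`) is an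
analytic (`C^ω`) manifold modelled on `𝕜ⁿ`, for every nontrivially normed field `𝕜`: the
transition maps `φⱼ ∘ φᵢ⁻¹` are quotients of coordinate functions (or `1`) by a coordinate that
does not vanish on `φᵢ(Uᵢ ∩ Uⱼ)`, hence analytic. This is exactly the argument of
[cite: HuybrechtsCG2005, §2.1 pp. 56–57 (Projective space; "These maps are obviously bijective and
holomorphic"), with Definition 2.1.1 p. 52], given there for `𝕜 = ℂ`; see also Griffiths–Harris
p. 15. Consumers holding `(h : isManifold_projectivization 𝕜 n)` are fed this theorem. -/
theorem isManifold_projectivization_holds : isManifold_projectivization 𝕜 n := by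
  unfold isManifold_projectivization
  refine isManifold_of_contDiffOn _ _ _ ?_
  rintro e e' ⟨i, rfl⟩ ⟨j, rfl⟩
  simp only [modelWithCornersSelf_coe, modelWithCornersSelf_coe_symm, comp_id, id_comp,
    preimage_id, range_id, inter_univ]
  exact contDiffOn_stdChart_symm_trans i j

end GlobalProofs

end Literature.NumberTheory.Transcendental
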